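import Mathlib.LinearAlgebra.BilinearForm.Properties
import Mathlib.LinearAlgebra.Matrix.ToLinearEquiv
import Mathlib.RingTheory.Trace.Basic
import Literature.NumberTheory.GaloisRepresentations.PstWeilDeligneTwistDeRham
import Literature.NumberTheory.GaloisRepresentations.FramedRepDualIrreducible
import HarnessLib

/-!
# Duals of de Rham representations are de Rham (Fontaine, Exp. III, Prop. 1.5.2 — the dual case)

Topic `NumberTheory/GaloisRepresentations`; theorems only (no definition, no named fact).  Generic `p`-adic
Hodge theory for an arbitrary period-ring datum `𝔅 : PeriodRingData Γ P E` (accepted `PAdicHodge`: a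
Fontaine-regular `(P, Γ)`-ring `B` with `B^Γ = E`, `D_B(V) = (B ⊗_P V)^Γ`,
`IsAdmissible 𝔅 ρ : dim_E D_B(V) = dim_P V`), continuing the accepted `PstWeilDeligneTwistDeRham` (the
comparison isomorphism `exists_basis_mem_D_of_isAdmissible` and its converse
`isAdmissible_of_span_D_eq_top`) and `PstWeilDeligneHeredity` (sub-objects, quotients, frames,
coefficients).  Source: Fontaine, Astérisque 223 (1994), Exposé III, Prop. 1.5.2 — the `B`-admissible
representations of `Γ` form a sub-Tannakian category of `Rep_P(Γ)`, in particular stable under DUALS —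
which the tree lacked (it had sub-objects / quotients / `⊕` / `⊗` / twists).  The dual case is what the
contragredient framed representations `FramedRep.dual ρ = ((ρ ·)ᵀ)⁻¹` of the tree (e.g. the `λ`-adic
representation of a Picard curve, `PicardLambdaAdicRepDivisible`, realised on the DUAL of the Tate module)
need in order to inherit de Rham-ness from a comparison theorem for the Tate module itself.

## The argument (period matrices)

For a finite-dimensional `P`-linear `ρ` on `V` with `P`-basis `v` and `R(σ)` the matrix of `ρ(σ)`:
* `exists_periodMatrix_of_isAdmissible` — if `V` is `B`-admissible there is an invertible
  **period matrix** `C ∈ GL_m(B)` with `R(σ) · σ(C) = C` for all `σ` (the coordinates in `1 ⊗ v` of the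
  invariant `B`-basis of `B ⊗_P V` given by the comparison isomorphism, Thm. 1.5.2);
* `isAdmissible_of_periodMatrix` — conversely such a `C` makes `V` admissible (its columns are `m`
  invariant vectors spanning `B ⊗_P V`);
* `periodMatrix_dual` — if `R(σ)ᵀ R'(σ) = 1` then `C' = (Cᵀ)⁻¹` satisfies `R'(σ) · σ(C') = C'` (pure matrix
  algebra: `σ` acts through a ring endomorphism of `M_m(B)`);
* `transpose_toMatrix_dualBasis_mul_toMatrix` — for a nondegenerate bilinear form `β` on `V` and
  endomorphisms `f`, `g` with `β(f x, g y) = β(x, y)`, the matrix `R'` of `f` in the `β`-dual basis of `v`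
  and the matrix `R` of `g` in `v` satisfy `R'ᵀ R = 1`;
* `isAdmissible_of_invariant_pairing` — hence: **if `ρ'`, `ρ` on the same space `V` leave a nondegenerate
  bilinear form invariant, `β(ρ'(σ)x, ρ(σ)y) = β(x, y)`, and `ρ` is admissible, then `ρ'` is admissible**
  (the contragredient `V^* ≅ V'` case of Prop. 1.5.2, in pairing form).

Framed consequences: for `r : Γ →ₜ* GL_n(E')`, `E'/ℚ_p` finite, the `ℚ_p`-restrictions of `r` and of its
inverse transpose `FramedRep.dual r` leave the trace pairing `(x, y) ↦ Tr_{E'/ℚ_p}(x ⬝ᵥ y)` on `E'ⁿ`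
invariant, and this pairing is nondegenerate (Mathlib `traceForm_nondegenerate`, `E'/ℚ_p` separable):
`PeriodRingData.isAdmissible_restrictScalars_dual(_iff)`.  With the bookkeeping `FramedRep.dual_baseChange`
(accepted, `FramedRepDualIrreducible`), `(Q r Q⁻¹)^∨ = Q^{-ᵀ} r^∨ Qᵀ` and `r^∨∨ = r` (private copies of the
lemmas of `PhiGammaModuleReindex`, whose heavy import cone is avoided), `HasQlModel.dual`, this gives
**`FramedRep.IsDeRhamWith.dual`** and **`PstWeilDeligneData.IsDeRhamFramed.dual`** (and the `iff` forms): for every `ℚ_ℓ`-structure and period-ring datum on a field `F`, in particular for every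
`p`-adic Hodge datum `𝔇` of a non-archimedean local field and for Fontaine's pinned datum, the dual of a de
Rham `T : Γ_F →ₜ* GL_n(ℚ̄_ℓ)` is de Rham; `FramedGaloisRep.dual_toLocal` records that dualising commutes with
restriction to a decomposition group.

## References
* [FontaineAsterisque223III] J.-M. Fontaine, *Représentations p-adiques semi-stables*, Astérisque 223
  (1994), Exp. III, §1.4 (regular `(F, G)`-rings), Thm. 1.5.2 (comparison isomorphism), Prop. 1.5.2
  (sub-objects, quotients, `⊕`, `⊗`, duals of `B`-admissible representations).
* [FontaineOuyang2022] J.-M. Fontaine, Y. Ouyang, *Theory of p-adic Galois representations*, Thm. 2.13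
  (`Rep_B(G)` is a sub-Tannakian category: stable under duals).
* [BuzzardGeeLMS2014] K. Buzzard, T. Gee, *The conjectural connections between automorphic
  representations and Galois representations* (2014), §2.2 (finite models, coefficient fields).
-/

noncomputable section

open scoped TensorProduct Matrix
open Field Literature.NumberTheory.Automorphic

namespace Literature.NumberTheory.GaloisRepresentations

/-! ### 0. Linear algebra: matrices in a dual basis; the dual of a period matrix -/

section LinearAlgebra

/-- **Matrices in the dual basis of an invariant pairing.**  Let `β` be a nondegenerate bilinear form on the
finite-dimensional `K`-space `V`, `v` a basis and `v'` its `β`-dual basis (`β(v'ᵢ, vⱼ) = δᵢⱼ`, Mathlib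
`LinearMap.BilinForm.dualBasis`).  If the endomorphisms `f`, `g` satisfy `β(f x, g y) = β(x, y)`, then the
matrix `R'` of `f` in `v'` and the matrix `R` of `g` in `v` satisfy `R'ᵀ R = 1` (so `R' = (Rᵀ)⁻¹` is the
contragredient matrix). [folklore] -/
theorem transpose_toMatrix_dualBasis_mul_toMatrix {K V ι : Type*} [Field K] [AddCommGroup V]
    [Module K V] [FiniteDimensional K V] [Fintype ι] [DecidableEq ι] (β : LinearMap.BilinForm K V)
    (hβ : β.Nondegenerate) (v : Module.Basis ι K V) (f g : V →ₗ[K] V)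
    (hfg : ∀ x y, β (f x) (g y) = β x y) :
    (LinearMap.toMatrix (β.dualBasis hβ v) (β.dualBasis hβ v) f)ᵀ * LinearMap.toMatrix v v g = 1 := by
  ext a b
  rw [Matrix.mul_apply, Matrix.one_apply]
  simp_rw [Matrix.transpose_apply, LinearMap.toMatrix_apply, LinearMap.BilinForm.dualBasis_repr_apply]
  have key : β (f (β.dualBasis hβ v a)) (g (v b)) =
      ∑ c, β (f (β.dualBasis hβ v a)) (v c) * v.repr (g (v b)) c := by
    conv_lhs => rw [← v.sum_repr (g (v b))]
    rw [map_sum]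
    refine Finset.sum_congr rfl fun c _ => ?_
    rw [map_smul, smul_eq_mul, mul_comm]
  rw [← key, hfg, LinearMap.BilinForm.apply_dualBasis_left]
  exact if_congr eq_comm rfl rfl

/-- **The dual of a period matrix.**  Let `Γ` act on the commutative ring `B` by ring automorphisms,
`f : P →+* B`, and let `C ∈ M_m(B)` with `det C` a unit satisfy `f(R) · σ(C) = C`.  If `Rᵀ R' = 1` in `M_m(P)`,
then `f(R') · σ((Cᵀ)⁻¹) = (Cᵀ)⁻¹`: transposing gives `σ(Cᵀ) f(Rᵀ) = Cᵀ`, hence `Cᵀ f(R') = σ(Cᵀ)`, and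
`Cᵀ · f(R') σ((Cᵀ)⁻¹) = σ(Cᵀ (Cᵀ)⁻¹) = 1`. [folklore] -/
theorem periodMatrix_dual {Γ : Type*} [Group Γ] {P B : Type*} [CommRing P] [CommRing B]
    [MulSemiringAction Γ B] (f : P →+* B) {ι : Type*} [Fintype ι] [DecidableEq ι]
    {R R' : Matrix ι ι P} {C : Matrix ι ι B} (σ : Γ) (hC : IsUnit C.det) (hRR' : Rᵀ * R' = 1)
    (hinv : R.map f * σ • C = C) : R'.map f * σ • (Cᵀ)⁻¹ = (Cᵀ)⁻¹ := by
  -- `σ` acts on matrices through the ring homomorphism `fσ.mapMatrix`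
  have hsmul : ∀ X : Matrix ι ι B, σ • X = (MulSemiringAction.toRingHom Γ B σ).mapMatrix X :=
    fun X => Matrix.ext fun i j => rfl
  have hCt : IsUnit Cᵀ.det := by rwa [Matrix.det_transpose]
  -- transpose the period relation and multiply by `f(R')`
  have h1 : σ • Cᵀ * Rᵀ.map f = Cᵀ := by
    have h := congrArg Matrix.transpose hinv
    rwa [Matrix.transpose_mul, Matrix.transpose_smul, ← Matrix.transpose_map] at h
  have h2 : Cᵀ * R'.map f = σ • Cᵀ := by
    have h : σ • Cᵀ * Rᵀ.map f * R'.map f = Cᵀ * R'.map f := by rw [h1]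
    rw [Matrix.mul_assoc, ← Matrix.map_mul, hRR', Matrix.map_one f (map_zero f) (map_one f),
      Matrix.mul_one] at h
    exact h.symm
  symm
  refine Matrix.inv_eq_right_inv ?_
  rw [← Matrix.mul_assoc, h2, hsmul, hsmul, ← map_mul, Matrix.mul_nonsing_inv _ hCt, map_one]

end LinearAlgebra

namespace PeriodRingData

-- Mathlib's own global value of `maxSynthPendingDepth` (the project default `1` makes nested
-- instance problems on `𝔅.B ⊗[P] M` fail spuriously; see the note in `PAdicHodgeProofs`).
set_option maxSynthPendingDepth 3

universe u v v' w w'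

variable {Γ : Type u} [Group Γ] [TopologicalSpace Γ] {P : Type v} {E : Type v'} [Field P]
  [TopologicalSpace P] [Field E] [Algebra P E]
  (𝔅 : PeriodRingData.{u, v, v', w} Γ P E)

/-! ### 1. Period matrices: admissible `↔` an invertible `C ∈ M_m(B)` with `R(σ) σ(C) = C` -/

section PeriodMatrix

variable {M : Type w'} [AddCommGroup M] [Module P M] [TopologicalSpace M] (ρ : ContinuousRep Γ P M)

/-- The diagonal action on the `B`-basis `1 ⊗ vᵢ` of `B ⊗_P V`: `σ(1 ⊗ vᵢ) = ∑ₖ R(σ)ₖᵢ (1 ⊗ vₖ)`, `R(σ)` the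
matrix of `ρ(σ)` in the basis `v`. [folklore] -/
theorem tensorRep_basis_apply {ι : Type*} [Fintype ι] [DecidableEq ι] (v : Module.Basis ι P M)
    (σ : Γ) (i : ι) :
    𝔅.tensorRep ρ σ (Algebra.TensorProduct.basis 𝔅.B v i) =
      ∑ k, algebraMap P 𝔅.B (LinearMap.toMatrix v v (ρ σ) k i) •
        Algebra.TensorProduct.basis 𝔅.B v k := by
  have hR : ρ σ (v i) = ∑ k, LinearMap.toMatrix v v (ρ σ) k i • v k := by
    have h1 := Matrix.toLin_self v v (LinearMap.toMatrix v v (ρ σ : M →ₗ[P] M)) i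
    rwa [Matrix.toLin_toMatrix] at h1
  rw [Algebra.TensorProduct.basis_apply, tensorRep_apply_tmul, smul_one, hR, TensorProduct.tmul_sum]
  refine Finset.sum_congr rfl fun k _ => ?_
  rw [TensorProduct.tmul_smul, algebraMap_smul, Algebra.TensorProduct.basis_apply]

/-- The diagonal action on a `B`-combination of the `1 ⊗ vᵢ` in matrix form:
`σ(∑ᵢ Cᵢⱼ (1 ⊗ vᵢ)) = ∑ₖ (R(σ) · σ(C))ₖⱼ (1 ⊗ vₖ)`. [folklore] -/
theorem tensorRep_sum_smul_basis {ι : Type*} [Fintype ι] [DecidableEq ι] (v : Module.Basis ι P M)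
    (σ : Γ) (C : Matrix ι ι 𝔅.B) (j : ι) :
    𝔅.tensorRep ρ σ (∑ i, C i j • Algebra.TensorProduct.basis 𝔅.B v i) =
      ∑ k, ((LinearMap.toMatrix v v (ρ σ)).map (algebraMap P 𝔅.B) * σ • C) k j •
        Algebra.TensorProduct.basis 𝔅.B v k := by
  rw [map_sum]
  simp_rw [tensorRep_apply_smul, tensorRep_basis_apply, Finset.smul_sum, smul_smul]
  rw [Finset.sum_comm]
  refine Finset.sum_congr rfl fun k _ => ?_
  rw [← Finset.sum_smul, Matrix.mul_apply]
  refine congrArg (· • Algebra.TensorProduct.basis 𝔅.B v k) (Finset.sum_congr rfl fun i _ => ?_)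
  rw [Matrix.map_apply, Matrix.smul_apply, mul_comm]

/-- **The period matrix of an admissible representation** (Fontaine, Exp. III, Thm. 1.5.2, coordinate
form).  If the finite-dimensional `V` is `B`-admissible and `v` is a `P`-basis of `V` (indexed by
`Fin (dim V)`), there is an invertible `C ∈ M_m(B)` with `R(σ) · σ(C) = C` for every `σ ∈ Γ`, where `R(σ)` is
the matrix of `ρ(σ)` in `v`: the coordinates in `1 ⊗ v` of the invariant `B`-basis of `B ⊗_P V`
(`exists_basis_mem_D_of_isAdmissible`). [cite: FontaineAsterisque223III, Exp. III Thm. 1.5.2] -/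
theorem exists_periodMatrix_of_isAdmissible [FiniteDimensional P M]
    (v : Module.Basis (Fin (Module.finrank P M)) P M) (h : 𝔅.IsAdmissible ρ) :
    ∃ C : Matrix (Fin (Module.finrank P M)) (Fin (Module.finrank P M)) 𝔅.B, IsUnit C ∧
      ∀ σ, (LinearMap.toMatrix v v (ρ σ)).map (algebraMap P 𝔅.B) * σ • C = C := by
  classical
  obtain ⟨b, hb⟩ := 𝔅.exists_basis_mem_D_of_isAdmissible ρ h
  set β := Algebra.TensorProduct.basis 𝔅.B v with hβ
  refine ⟨β.toMatrix b, ⟨⟨β.toMatrix b, b.toMatrix β, β.toMatrix_mul_toMatrix_flip b,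
    b.toMatrix_mul_toMatrix_flip β⟩, rfl⟩, fun σ => ?_⟩
  have hd : ∀ j, (b j : 𝔅.B ⊗[P] M) = ∑ i, β.toMatrix b i j • β i := fun j => by
    simp_rw [Module.Basis.toMatrix_apply]
    exact (β.sum_repr (b j)).symm
  refine Matrix.ext fun k j => ?_
  have h1 := 𝔅.tensorRep_sum_smul_basis ρ v σ (β.toMatrix b) j
  rw [← hd j, (𝔅.mem_D_iff ρ _).1 (hb j) σ] at h1
  have h2 := β.repr_sum_self fun k =>
    ((LinearMap.toMatrix v v (ρ σ)).map (algebraMap P 𝔅.B) * σ • β.toMatrix b) k j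
  rw [← h1] at h2
  rw [Module.Basis.toMatrix_apply β b k j]
  exact (congrFun h2 k).symm

/-- **A period matrix makes a representation admissible** (converse of
`exists_periodMatrix_of_isAdmissible`): if `C ∈ M_ι(B)` has unit determinant and `R(σ) · σ(C) = C` for all
`σ`, `R(σ)` the matrix of `ρ(σ)` in the `P`-basis `v`, then `V` is `B`-admissible — the columns
`dⱼ = ∑ᵢ Cᵢⱼ (1 ⊗ vᵢ)` are invariant and form a `B`-basis of `B ⊗_P V`, so `D_B(V)` spans
(`isAdmissible_of_span_D_eq_top`). [cite: FontaineAsterisque223III, Exp. III Thm. 1.5.2] -/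
theorem isAdmissible_of_periodMatrix [FiniteDimensional P M] {ι : Type*} [Fintype ι] [DecidableEq ι]
    (v : Module.Basis ι P M) (C : Matrix ι ι 𝔅.B) (hC : IsUnit C.det)
    (hinv : ∀ σ, (LinearMap.toMatrix v v (ρ σ)).map (algebraMap P 𝔅.B) * σ • C = C) :
    𝔅.IsAdmissible ρ := by
  classical
  set β := Algebra.TensorProduct.basis 𝔅.B v with hβ
  -- the invariant vectors `d j = toLin β β C (β j)`
  have hdD : ∀ j, Matrix.toLin β β C (β j) ∈ 𝔅.D ρ := fun j => (𝔅.mem_D_iff ρ _).2 fun σ => by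
    rw [Matrix.toLin_self, 𝔅.tensorRep_sum_smul_basis ρ v σ C j, hinv σ]
  refine 𝔅.isAdmissible_of_span_D_eq_top ρ (eq_top_iff.2 ?_)
  have hrange : Set.range (fun j => Matrix.toLin β β C (β j)) ⊆ (𝔅.D ρ : Set (𝔅.B ⊗[P] M)) := by
    rintro _ ⟨j, rfl⟩
    exact hdD j
  calc (⊤ : Submodule 𝔅.B (𝔅.B ⊗[P] M)) = LinearMap.range (Matrix.toLin β β C) :=
        (Matrix.range_toLin_eq_top β C hC).symm
    _ = Submodule.span 𝔅.B (Set.range fun j => Matrix.toLin β β C (β j)) := by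
        rw [LinearMap.range_eq_map, ← β.span_eq, Submodule.map_span, ← Set.range_comp]
        rfl
    _ ≤ Submodule.span 𝔅.B (𝔅.D ρ : Set (𝔅.B ⊗[P] M)) := Submodule.span_mono hrange

/-- **Duals of admissible representations are admissible, in pairing form** (Fontaine, Exp. III,
Prop. 1.5.2: `Rep_B(Γ)` is stable under duals).  Let `ρ`, `ρ'` be continuous `P`-linear representations of
`Γ` on the same finite-dimensional `V` leaving a nondegenerate bilinear form invariant,
`β(ρ'(σ)x, ρ(σ)y) = β(x, y)` (so `ρ' ≅ ρ^*`, the contragredient).  If `ρ` is `B`-admissible, so is `ρ'`: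
a period matrix `C` of `ρ` in a basis `v` (`exists_periodMatrix_of_isAdmissible`) yields the period matrix
`(Cᵀ)⁻¹` of `ρ'` in the `β`-dual basis (`transpose_toMatrix_dualBasis_mul_toMatrix`, `periodMatrix_dual`),
whence `ρ'` is admissible (`isAdmissible_of_periodMatrix`).
[cite: FontaineAsterisque223III, Exp. III Prop. 1.5.2] [cite: FontaineOuyang2022, Thm. 2.13] -/
theorem isAdmissible_of_invariant_pairing [FiniteDimensional P M] (ρ' : ContinuousRep Γ P M)
    (β : LinearMap.BilinForm P M) (hβ : β.Nondegenerate)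
    (hinvar : ∀ (σ : Γ) (x y : M), β (ρ' σ x) (ρ σ y) = β x y) (h : 𝔅.IsAdmissible ρ) :
    𝔅.IsAdmissible ρ' := by
  classical
  let v := Module.finBasis P M
  obtain ⟨C, hCu, hC⟩ := 𝔅.exists_periodMatrix_of_isAdmissible ρ v h
  let v' := β.dualBasis hβ v
  have hRR' : ∀ σ, (LinearMap.toMatrix v v (ρ σ))ᵀ * LinearMap.toMatrix v' v' (ρ' σ) = 1 := fun σ => by
    have h1 := congrArg Matrix.transpose
      (transpose_toMatrix_dualBasis_mul_toMatrix β hβ v (ρ' σ) (ρ σ) (hinvar σ))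
    rwa [Matrix.transpose_mul, Matrix.transpose_transpose, Matrix.transpose_one] at h1
  have hCdet : IsUnit C.det := (Matrix.isUnit_iff_isUnit_det C).1 hCu
  refine 𝔅.isAdmissible_of_periodMatrix ρ' v' (Cᵀ)⁻¹ ?_ fun σ =>
    periodMatrix_dual (algebraMap P 𝔅.B) σ hCdet (hRR' σ) (hC σ)
  rw [Matrix.isUnit_nonsing_inv_det_iff, Matrix.det_transpose]
  exact hCdet

end PeriodMatrix

end PeriodRingData

/-! ### 2. Inverse transpose: bookkeeping of frames, coefficients and restriction -/

section Dual

variable {G : Type*} [Group G] [TopologicalSpace G] {A : Type*} [CommRing A] [TopologicalSpace A] {n : ℕ}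

/-- `glTransposeInv` is an involution: `((gᵀ)⁻¹)ᵀ)⁻¹ = g` (private copy of the lemma of
`PhiGammaModuleReindex`, whose import cone is deliberately avoided here). [folklore] -/
private theorem glTransposeInv_glTransposeInv' {ι : Type*} [Fintype ι] [DecidableEq ι] (g : GL ι A) :
    glTransposeInv ι A (glTransposeInv ι A g) = g := by
  refine Units.ext ?_
  rw [coe_glTransposeInv_apply, ← map_inv, coe_glTransposeInv_apply, inv_inv, Matrix.transpose_transpose]

/-- The dual of the dual framed representation is the original one (private copy of
`FramedRep.dual_dual` of `PhiGammaModuleReindex`). [folklore] -/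
private theorem FramedRep.dual_dual' (ρ : FramedRep G A n) : ρ.dual.dual = ρ :=
  ContinuousMonoidHom.ext fun g => glTransposeInv_glTransposeInv' (ρ g)

/-- Dualising a conjugate: `(Q ρ Q⁻¹)^∨ = Q^{-ᵀ} ρ^∨ Qᵀ`, i.e. conjugation by `glTransposeInv Q` (private
copy of `FramedRep.dual_conj` of `PhiGammaModuleReindex`). [folklore] -/
private theorem FramedRep.dual_conj' [IsTopologicalRing A] (Q : GL (Fin n) A) (ρ : FramedRep G A n) :
    (FramedRep.conj Q ρ).dual = FramedRep.conj (glTransposeInv (Fin n) A Q) ρ.dual := by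
  refine ContinuousMonoidHom.ext fun g => ?_
  change glTransposeInv (Fin n) A (Q * ρ g * Q⁻¹) =
    glTransposeInv (Fin n) A Q * glTransposeInv (Fin n) A (ρ g) * (glTransposeInv (Fin n) A Q)⁻¹
  rw [map_mul, map_mul, map_inv]

/-- Dualising commutes with restriction to the decomposition group at a finite place (both are
compositions of continuous homomorphisms). [folklore] -/
theorem FramedGaloisRep.dual_toLocal {K : Type*} [Field K] [NumberField K]
    (v : IsDedekindDomain.HeightOneSpectrum (NumberField.RingOfIntegers K)) (ρ : FramedGaloisRep K A n) :
    FramedGaloisRep.toLocal v (FramedRep.dual ρ) = FramedRep.dual (ρ.toLocal v) :=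
  rfl

/-- A finite model of `T` over `E ⊆ ℚ̄_ℓ` gives the finite model `rE^∨` of `T^∨` over the same `E`
(frame `P^{-ᵀ}`; accepted `HasQlModel`). [cite: BuzzardGeeLMS2014, §2.2] -/
theorem _root_.Literature.NumberTheory.Automorphic.HasQlModel.dual {K : Type*} [Field K] {ℓ : ℕ}
    [Fact ℓ.Prime] {T : FramedGaloisRep K (PadicAlgCl ℓ) n} {E : IntermediateField ℚ_[ℓ] (PadicAlgCl ℓ)}
    {rE : FramedGaloisRep K E n} (h : HasQlModel T E rE) :
    HasQlModel (FramedRep.dual T) E (FramedRep.dual rE) := by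
  obtain ⟨P, hP⟩ := h
  refine ⟨glTransposeInv (Fin n) (PadicAlgCl ℓ) P, ?_⟩
  rw [← FramedRep.dual_baseChange, ← FramedRep.dual_conj', hP]

end Dual

/-! ### 3. The trace pairing on `E'ⁿ`; duals of admissible framed representations are admissible -/

section TracePairing

variable {p : ℕ} [Fact p.Prime] {Γ : Type*} [Group Γ] [TopologicalSpace Γ] {n : ℕ}
  {E' : Type*} [Field E'] [Algebra ℚ_[p] E'] [TopologicalSpace E'] [IsTopologicalRing E']

/-- **The trace pairing `β(x, y) = Tr_{E'/ℚ_p}(x ⬝ᵥ y)` on `E'ⁿ` is a nondegenerate `ℚ_p`-bilinear form left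
invariant by `(r^∨, r)`** for every framed `r : Γ →ₜ* GL_n(E')`, `E'/ℚ_p` finite: invariance is
`((Aᵀ)⁻¹ x) ⬝ᵥ (A y) = x ⬝ᵥ y`, nondegeneracy is that of the trace form of the separable extension `E'/ℚ_p`
(Mathlib `traceForm_nondegenerate`) tested on the vectors `Pi.single i a`. [folklore] -/
theorem FramedRep.exists_bilinForm_dual_invariant [FiniteDimensional ℚ_[p] E'] (r : FramedRep Γ E' n) :
    ∃ β : LinearMap.BilinForm ℚ_[p] (Fin n → E'), β.Nondegenerate ∧
      ∀ (σ : Γ) (x y : Fin n → E'),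
        β (FramedRep.restrictScalars ℚ_[p] r.dual σ x) (FramedRep.restrictScalars ℚ_[p] r σ y) = β x y := by
  classical
  let β : LinearMap.BilinForm ℚ_[p] (Fin n → E') :=
    LinearMap.mk₂ ℚ_[p] (fun x y => Algebra.trace ℚ_[p] E' (x ⬝ᵥ y))
      (fun x x' y => by rw [add_dotProduct, map_add])
      (fun c x y => by rw [smul_dotProduct, map_smul])
      (fun x y y' => by rw [dotProduct_add, map_add])
      (fun c x y => by rw [dotProduct_smul, map_smul])
  have hβ : ∀ x y, β x y = Algebra.trace ℚ_[p] E' (x ⬝ᵥ y) := fun _ _ => rfl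
  -- nondegeneracy (the form is symmetric, so left-separating suffices for both halves)
  have hsep : ∀ x : Fin n → E', (∀ y, β x y = 0) → x = 0 := fun x hx => funext fun i => by
    refine (traceForm_nondegenerate ℚ_[p] E').1 (x i) fun a => ?_
    have h1 : x ⬝ᵥ Pi.single i a = x i * a := by simp
    rw [Algebra.traceForm_apply, ← h1, ← hβ]
    exact hx _
  refine ⟨β, ⟨hsep, fun y hy => hsep y fun x => ?_⟩, fun σ x y => ?_⟩
  · rw [hβ, dotProduct_comm, ← hβ]
    exact hy x
  · rw [hβ, hβ, FramedRep.restrictScalars_apply_apply, FramedRep.restrictScalars_apply_apply,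
      FramedRep.coe_dual_apply, Matrix.mulVec_transpose, Matrix.dotProduct_mulVec, Matrix.vecMul_vecMul,
      ← Units.val_mul, inv_mul_cancel, Units.val_one, Matrix.vecMul_one]

end TracePairing

namespace PeriodRingData

section Framed

-- Mathlib's own global value (nested instance problems on `𝔅.B ⊗[P] M`, see `PAdicHodgeProofs`).
set_option maxSynthPendingDepth 3

universe u v' v'' w

variable {p : ℕ} [Fact p.Prime] {Γ : Type u} [Group Γ] [TopologicalSpace Γ]
  {E₁ : Type v'} [Field E₁] [Algebra ℚ_[p] E₁] (𝔅 : PeriodRingData.{u, 0, v', w} Γ ℚ_[p] E₁) {n : ℕ}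
  {E' : Type v''} [Field E'] [Algebra ℚ_[p] E'] [TopologicalSpace E'] [IsTopologicalRing E']

/-- **The inverse transpose of an admissible framed representation is admissible** (framed form of
Fontaine's Prop. 1.5.2, duals): for `r : Γ →ₜ* GL_n(E')` with `E'/ℚ_p` finite, if the `ℚ_p`-restriction of `r`
is `B`-admissible then so is that of `r^∨ = ((r ·)ᵀ)⁻¹` — `isAdmissible_of_invariant_pairing` for the trace
pairing of `FramedRep.exists_bilinForm_dual_invariant`.
[cite: FontaineAsterisque223III, Exp. III Prop. 1.5.2] -/
theorem isAdmissible_restrictScalars_dual [FiniteDimensional ℚ_[p] E'] (r : FramedRep Γ E' n)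
    (h : 𝔅.IsAdmissible (FramedRep.restrictScalars ℚ_[p] r)) :
    𝔅.IsAdmissible (FramedRep.restrictScalars ℚ_[p] r.dual) := by
  obtain ⟨β, hβ, hinv⟩ := FramedRep.exists_bilinForm_dual_invariant (p := p) r
  exact 𝔅.isAdmissible_of_invariant_pairing _ _ β hβ hinv h

/-- The `ℚ_p`-restriction of `r^∨` is `B`-admissible iff that of `r` is (`r^∨∨ = r`).
[cite: FontaineAsterisque223III, Exp. III Prop. 1.5.2] -/
theorem isAdmissible_restrictScalars_dual_iff [FiniteDimensional ℚ_[p] E'] (r : FramedRep Γ E' n) :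
    𝔅.IsAdmissible (FramedRep.restrictScalars ℚ_[p] r.dual) ↔
      𝔅.IsAdmissible (FramedRep.restrictScalars ℚ_[p] r) := by
  refine ⟨fun h => ?_, 𝔅.isAdmissible_restrictScalars_dual r⟩
  have h2 := 𝔅.isAdmissible_restrictScalars_dual r.dual h
  rwa [FramedRep.dual_dual'] at h2

end Framed

end PeriodRingData

/-! ### 4. Duals of de Rham representations are de Rham -/

section DeRham

variable {F : Type} [Field F] {ℓ : ℕ} [Fact ℓ.Prime]

-- Mathlib's own global value (nested instance problems on `𝔅.B ⊗[P] M`, see `PAdicHodgeProofs`).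
set_option maxSynthPendingDepth 3 in
/-- **The dual of a de Rham framed representation is de Rham** (Fontaine, Exp. III, Prop. 1.5.2: the
`B`-admissible representations are stable under duals), for every `ℚ_ℓ`-algebra structure `alg` on the field
`F` and every period-ring datum `𝔅` for `Γ_F` (accepted `FramedRep.IsDeRhamWith`): a finite model `rE` of
`T` over `E` gives the model `rE^∨` of `T^∨` (`HasQlModel.dual`), and the `ℚ_ℓ`-restriction of `rE^∨` is
admissible with that of `rE` (`PeriodRingData.isAdmissible_restrictScalars_dual`).
[cite: FontaineAsterisque223III, Exp. III Prop. 1.5.2] -/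
theorem FramedRep.IsDeRhamWith.dual (alg : Algebra ℚ_[ℓ] F)
    (𝔅 : PeriodRingData.{0, 0, 0, 0} (absoluteGaloisGroup F) ℚ_[ℓ] F) {n : ℕ}
    {T : FramedRep (absoluteGaloisGroup F) (PadicAlgCl ℓ) n} (h : T.IsDeRhamWith alg 𝔅) :
    (FramedRep.dual T).IsDeRhamWith alg 𝔅 := by
  letI := alg
  obtain ⟨E, hE, rE, hmodel, hadm⟩ := h
  haveI := hE
  exact ⟨E, hE, FramedRep.dual rE, hmodel.dual, 𝔅.isAdmissible_restrictScalars_dual rE hadm⟩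

/-- `T^∨` is de Rham iff `T` is (`T^∨∨ = T`). [cite: FontaineAsterisque223III, Exp. III Prop. 1.5.2] -/
theorem FramedRep.isDeRhamWith_dual_iff (alg : Algebra ℚ_[ℓ] F)
    (𝔅 : PeriodRingData.{0, 0, 0, 0} (absoluteGaloisGroup F) ℚ_[ℓ] F) {n : ℕ}
    (T : FramedRep (absoluteGaloisGroup F) (PadicAlgCl ℓ) n) :
    (FramedRep.dual T).IsDeRhamWith alg 𝔅 ↔ T.IsDeRhamWith alg 𝔅 := by
  refine ⟨fun h => ?_, fun h => h.dual alg 𝔅⟩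
  have h2 := h.dual alg 𝔅
  rwa [FramedRep.dual_dual'] at h2

variable [ValuativeRel F] [TopologicalSpace F] [IsNonarchimedeanLocalField F]

/-- **The dual of a de Rham representation is de Rham, for a `p`-adic Hodge datum** (accepted
`PstWeilDeligneData`, `IsDeRhamFramed`): for every non-archimedean local field `F`, prime `ℓ` and datum `𝔇`,
if `T : Γ_F →ₜ* GL_n(ℚ̄_ℓ)` is de Rham for `𝔇` then so is `T^∨ = FramedRep.dual T`
(`FramedRep.IsDeRhamWith.dual` for `(𝔇.algebra, 𝔇.𝔅)`).
[cite: FontaineAsterisque223III, Exp. III Prop. 1.5.2] -/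
theorem PstWeilDeligneData.IsDeRhamFramed.dual {𝔇 : PstWeilDeligneData F ℓ} {n : ℕ}
    {T : FramedRep (absoluteGaloisGroup F) (PadicAlgCl ℓ) n} (h : 𝔇.IsDeRhamFramed T) :
    𝔇.IsDeRhamFramed (FramedRep.dual T) :=
  FramedRep.IsDeRhamWith.dual 𝔇.algebra 𝔇.𝔅 h

/-- `T^∨` is de Rham for `𝔇` iff `T` is. [cite: FontaineAsterisque223III, Exp. III Prop. 1.5.2] -/
theorem PstWeilDeligneData.isDeRhamFramed_dual_iff (𝔇 : PstWeilDeligneData F ℓ) {n : ℕ}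
    (T : FramedRep (absoluteGaloisGroup F) (PadicAlgCl ℓ) n) :
    𝔇.IsDeRhamFramed (FramedRep.dual T) ↔ 𝔇.IsDeRhamFramed T :=
  FramedRep.isDeRhamWith_dual_iff 𝔇.algebra 𝔇.𝔅 T

/-- **For Fontaine's pinned datum** (accepted `PAdicHodge.fontainePst`: period ring `B_dR(F)`): the dual of a
de Rham `T : Γ_F →ₜ* GL_n(ℚ̄_ℓ)` is de Rham — genuine `B_dR`-admissibility of a finite model of `T^∨`.
[cite: FontaineAsterisque223III, Exp. III Prop. 1.5.2] -/
theorem fontainePst_isDeRhamFramed_dual [CharZero F] (hℓ : ValuativeRel.valuation F ℓ < 1)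
    {n : ℕ} {T : FramedRep (absoluteGaloisGroup F) (PadicAlgCl ℓ) n}
    (h : (Literature.NumberTheory.PAdicHodge.fontainePst F ℓ hℓ).IsDeRhamFramed T) :
    (Literature.NumberTheory.PAdicHodge.fontainePst F ℓ hℓ).IsDeRhamFramed (FramedRep.dual T) :=
  h.dual

end DeRham

/-- **For the pinned datum of a completion** `K_v`, `v ∣ ℓ`, of a number field (accepted
`PAdicHodge.fontainePstAdicCompletion`, the term of the summit statements and of
`picardCurve_exists_lambdaAdicRep_isDeRhamFramed`): if `ρ|_{Γ_{K_v}}` is de Rham then so is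
`ρ^∨|_{Γ_{K_v}} = (ρ|_{Γ_{K_v}})^∨`. [cite: FontaineAsterisque223III, Exp. III Prop. 1.5.2] -/
theorem fontainePstAdicCompletion_isDeRhamFramed_dual_toLocal {K : Type} [Field K]
    [NumberField K] (v : IsDedekindDomain.HeightOneSpectrum (NumberField.RingOfIntegers K)) (ℓ : ℕ)
    [Fact ℓ.Prime] (hv : ((ℓ : ℕ) : NumberField.RingOfIntegers K) ∈ v.asIdeal) {n : ℕ}
    {ρ : FramedGaloisRep K (PadicAlgCl ℓ) n}
    (h : (Literature.NumberTheory.PAdicHodge.fontainePstAdicCompletion v ℓ hv).IsDeRhamFramed (ρ.toLocal v)) :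
    (Literature.NumberTheory.PAdicHodge.fontainePstAdicCompletion v ℓ hv).IsDeRhamFramed
      (FramedGaloisRep.toLocal v (FramedRep.dual ρ)) := by
  rw [FramedGaloisRep.dual_toLocal]
  exact h.dual

end Literature.NumberTheory.GaloisRepresentations

end
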